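import Mathlib
import Summits.Ventures.PercRepro2.Defs
import Summits.Ventures.PercRepro2.Independence
import Summits.Ventures.PercRepro2.Harris
import Summits.Ventures.PercRepro2.CoinDefs
import Summits.Ventures.PercRepro2.CoinArcsOff
import Summits.Ventures.PercRepro2.CoinPendantDefs
import Summits.Ventures.PercRepro2.CoinPendant
import Summits.Ventures.PercRepro2.CoinInduced
import Summits.Ventures.PercRepro2.CoinVdBK
import Summits.Ventures.PercRepro2.CoinBHK
import Summits.Ventures.PercRepro2.CoinReverse
import Summits.Ventures.PercRepro2.CoinTwoPendantDefs
import Summits.Ventures.PercRepro2.CoinTwoPendantMass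
import Summits.Ventures.PercRepro2.CoinTraceLevels
import Summits.Ventures.PercRepro2.CoinTraceTower
import Summits.Ventures.PercRepro2.CoinTracePin
import Summits.Ventures.PercRepro2.CoinTracePin2

/-!
# The PINNING TRANSFER, once and for all (blind cell PercRepro2, night-2 g4;
proofs/NIGHT2-DARC.md §24)

`trace_pin_transfer`: if a (CU-PA)-type inequality holds on a family `{Z : Q Z}` of traces for
EVERY probability vector, then it holds on the family `{Z : Q Z ∧ v ∈ Z}` for `p`, whenever the
leaf `v` is decided by the single pendant coin `c` (`{v ∈ K⁻} = {c open}`): apply the inequality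
to `p[c ↦ 1]` and translate — `μ_Z = p_c · μ′_Z` on `{Z ∋ v}` (`prob_eq_mul_prob_update_one_of_subset`),
`μ′_Z = 0` off it (`prob_update_one_eq_zero_of_subset`), the reduced events unchanged
(`dependsOn_avoid_reduced_compl_single`).  This is the proof of `trace_cu_pa` with the inner
`trace_pa` abstracted away; iterating it gives (CU-PA) on every cylinder `{Z ⊇ V′}` whose
vertices are decided by pendant coins: `trace_cu_pa_pair` (two leaves) and `trace_cu_pa_pair₂`
(a two-coin vertex and a leaf) below — the pair cylinders the pathstar and the two-chains
heads need.
-/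

namespace Summit.Ventures.PercRepro2.Coin

section PinTransfer

open Classical

variable {V : Type*} {E : Type*} [Fintype V] [DecidableEq V] [Fintype E] [DecidableEq E]
  {R : Type*} [Field R] [LinearOrder R] [IsStrictOrderedRing R]

omit [Fintype V] in
/-- **The pinning transfer.** -/
theorem trace_pin_transfer (p : E → R) (hp : IsProbVec p) {arcs : E → Finset (V × V)}
    {P : Finset V} {t : V} (hT : TailCoinsIn arcs P {t}) {v : V} (hv : v ∈ P) {c : E}
    (hc : c ∈ tailCoins arcs P) (hleaf : bwdEvent arcs v {t} = openEdge c) (s : V)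
    (Q : Finset V → Prop) [DecidablePred Q] (g₁ g₂ : Set V → R)
    (hinner : ∀ q : E → R, IsProbVec q →
      (∑ Z ∈ P.powerset.filter Q,
          g₁ ↑Z * (prob q (traceLevel arcs {t} P Z) *
            prob q (avoidEvent (arcsOff arcs (P ∪ {t})) s (Z ∪ {t}))))
        * (∑ Z ∈ P.powerset.filter Q,
          g₂ ↑Z * (prob q (traceLevel arcs {t} P Z) *
            prob q (avoidEvent (arcsOff arcs (P ∪ {t})) s (Z ∪ {t})))) ≤
      (∑ Z ∈ P.powerset.filter Q,
          g₁ ↑Z * g₂ ↑Z * (prob q (traceLevel arcs {t} P Z) *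
            prob q (avoidEvent (arcsOff arcs (P ∪ {t})) s (Z ∪ {t}))))
        * (∑ Z ∈ P.powerset.filter Q,
          prob q (traceLevel arcs {t} P Z) *
            prob q (avoidEvent (arcsOff arcs (P ∪ {t})) s (Z ∪ {t})))) :
    (∑ Z ∈ P.powerset.filter (fun Z => Q Z ∧ v ∈ Z),
        g₁ ↑Z * (prob p (traceLevel arcs {t} P Z) *
          prob p (avoidEvent (arcsOff arcs (P ∪ {t})) s (Z ∪ {t}))))
      * (∑ Z ∈ P.powerset.filter (fun Z => Q Z ∧ v ∈ Z),
        g₂ ↑Z * (prob p (traceLevel arcs {t} P Z) *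
          prob p (avoidEvent (arcsOff arcs (P ∪ {t})) s (Z ∪ {t})))) ≤
    (∑ Z ∈ P.powerset.filter (fun Z => Q Z ∧ v ∈ Z),
        g₁ ↑Z * g₂ ↑Z * (prob p (traceLevel arcs {t} P Z) *
          prob p (avoidEvent (arcsOff arcs (P ∪ {t})) s (Z ∪ {t}))))
      * (∑ Z ∈ P.powerset.filter (fun Z => Q Z ∧ v ∈ Z),
        prob p (traceLevel arcs {t} P Z) *
          prob p (avoidEvent (arcsOff arcs (P ∪ {t})) s (Z ∪ {t}))) := by
  set p' := Function.update p c 1 with hp'def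
  have hp' : IsProbVec p' := hp.update c zero_le_one le_rfl
  have hpc : 0 ≤ p c := hp.nonneg c
  -- the pinned trace law
  have hR : ∀ Z : Finset V, prob p' (avoidEvent (arcsOff arcs (P ∪ {t})) s (Z ∪ {t})) =
      prob p (avoidEvent (arcsOff arcs (P ∪ {t})) s (Z ∪ {t})) := fun Z =>
    prob_update_one_of_dependsOn p c (dependsOn_avoid_reduced_compl_single hT hc s _)
  have hμ : ∀ Z : Finset V, v ∈ Z →
      prob p (traceLevel arcs {t} P Z) * prob p (avoidEvent (arcsOff arcs (P ∪ {t})) s (Z ∪ {t}))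
        = p c * (prob p' (traceLevel arcs {t} P Z) *
          prob p' (avoidEvent (arcsOff arcs (P ∪ {t})) s (Z ∪ {t}))) := by
    intro Z hvZ
    rw [hR Z, prob_eq_mul_prob_update_one_of_subset p c (traceLevel_subset_openEdge hv hleaf hvZ)]
    ring
  have hμ0 : ∀ Z : Finset V, v ∉ Z → prob p' (traceLevel arcs {t} P Z) = 0 := fun Z hvZ =>
    prob_update_one_eq_zero_of_subset p c (traceLevel_subset_closedEdge hv hleaf hvZ)
  -- sums over the pinned law restrict from `{Q}` to `{Q ∧ v ∈ Z}`
  have hsum : ∀ F : Finset V → R,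
      ∑ Z ∈ P.powerset.filter Q,
          F Z * (prob p' (traceLevel arcs {t} P Z) *
            prob p' (avoidEvent (arcsOff arcs (P ∪ {t})) s (Z ∪ {t}))) =
        ∑ Z ∈ P.powerset.filter (fun Z => Q Z ∧ v ∈ Z),
          F Z * (prob p' (traceLevel arcs {t} P Z) *
            prob p' (avoidEvent (arcsOff arcs (P ∪ {t})) s (Z ∪ {t}))) := by
    intro F
    rw [Finset.sum_filter, Finset.sum_filter]
    refine Finset.sum_congr rfl fun Z _ => ?_
    by_cases hQ : Q Z
    · by_cases hvZ : v ∈ Z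
      · simp only [hQ, hvZ, and_self, if_true]
      · simp only [hQ, hvZ, and_false, if_true, if_false, hμ0 Z hvZ, zero_mul, mul_zero]
    · simp only [hQ, false_and, if_false]
  -- the original sums are `p c` times the pinned ones
  have hconv : ∀ F : Finset V → R,
      ∑ Z ∈ P.powerset.filter (fun Z => Q Z ∧ v ∈ Z),
          F Z * (prob p (traceLevel arcs {t} P Z) *
            prob p (avoidEvent (arcsOff arcs (P ∪ {t})) s (Z ∪ {t}))) =
        p c * ∑ Z ∈ P.powerset.filter (fun Z => Q Z ∧ v ∈ Z),
          F Z * (prob p' (traceLevel arcs {t} P Z) *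
            prob p' (avoidEvent (arcsOff arcs (P ∪ {t})) s (Z ∪ {t}))) := by
    intro F
    rw [Finset.mul_sum]
    refine Finset.sum_congr rfl fun Z hZ => ?_
    rw [hμ Z (Finset.mem_filter.mp hZ).2.2]
    ring
  have h := hinner p' hp'
  have h1 := hsum (fun Z => g₁ ↑Z)
  have h2 := hsum (fun Z => g₂ ↑Z)
  have h12 := hsum (fun Z => g₁ ↑Z * g₂ ↑Z)
  have h0 := hsum (fun _ => 1)
  simp only [one_mul] at h0
  rw [h1, h2, h12, h0] at h
  have c1 := hconv (fun Z => g₁ ↑Z)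
  have c2 := hconv (fun Z => g₂ ↑Z)
  have c12 := hconv (fun Z => g₁ ↑Z * g₂ ↑Z)
  have c0 := hconv (fun _ => 1)
  simp only [one_mul] at c0
  rw [c1, c2, c12, c0]
  have hsq : 0 ≤ p c * p c := mul_nonneg hpc hpc
  have := mul_le_mul_of_nonneg_left h hsq
  calc p c * _ * (p c * _) = p c * p c * (_ * _) := by ring
    _ ≤ p c * p c * (_ * _) := this
    _ = _ := by ring

/-- **(CU-PA) on the PAIR cylinder of two leaves** `v, v'` decided by the pendant coins `c₁, c₂`. -/
theorem trace_cu_pa_pair (p : E → R) (hp : IsProbVec p) {arcs : E → Finset (V × V)}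
    (hS : SameEnds arcs) {P : Finset V} {t : V} (hclosed : ClosedOut arcs P {t})
    (hT : TailCoinsIn arcs P {t}) {v v' : V} (hv : v ∈ P) (hv' : v' ∈ P) {c₁ c₂ : E}
    (hc₁ : c₁ ∈ tailCoins arcs P) (hc₂ : c₂ ∈ tailCoins arcs P)
    (hleaf₁ : bwdEvent arcs v {t} = openEdge c₁) (hleaf₂ : bwdEvent arcs v' {t} = openEdge c₂)
    (s : V) {g₁ g₂ : Set V → R}
    (h₁ : Monotone g₁) (h₂ : Monotone g₂) (h₁0 : ∀ S, 0 ≤ g₁ S) (h₂0 : ∀ S, 0 ≤ g₂ S) :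
    (∑ Z ∈ P.powerset.filter (fun Z => v ∈ Z ∧ v' ∈ Z),
        g₁ ↑Z * (prob p (traceLevel arcs {t} P Z) *
          prob p (avoidEvent (arcsOff arcs (P ∪ {t})) s (Z ∪ {t}))))
      * (∑ Z ∈ P.powerset.filter (fun Z => v ∈ Z ∧ v' ∈ Z),
        g₂ ↑Z * (prob p (traceLevel arcs {t} P Z) *
          prob p (avoidEvent (arcsOff arcs (P ∪ {t})) s (Z ∪ {t})))) ≤
    (∑ Z ∈ P.powerset.filter (fun Z => v ∈ Z ∧ v' ∈ Z),
        g₁ ↑Z * g₂ ↑Z * (prob p (traceLevel arcs {t} P Z) *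
          prob p (avoidEvent (arcsOff arcs (P ∪ {t})) s (Z ∪ {t}))))
      * (∑ Z ∈ P.powerset.filter (fun Z => v ∈ Z ∧ v' ∈ Z),
        prob p (traceLevel arcs {t} P Z) *
          prob p (avoidEvent (arcsOff arcs (P ∪ {t})) s (Z ∪ {t}))) :=
  trace_pin_transfer p hp hT hv' hc₂ hleaf₂ s (fun Z => v ∈ Z) g₁ g₂ fun q hq =>
    trace_cu_pa q hq hS hclosed hT hv hc₁ hleaf₁ s h₁ h₂ h₁0 h₂0

/-- **(CU-PA) on the PAIR cylinder of a two-coin vertex and a leaf**: `v` decided by `c₁, c₂`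
(`c₁ ≠ c₂`), `v'` by `c₃`. -/
theorem trace_cu_pa_pair₂ (p : E → R) (hp : IsProbVec p) {arcs : E → Finset (V × V)}
    (hS : SameEnds arcs) {P : Finset V} {t : V} (hclosed : ClosedOut arcs P {t})
    (hT : TailCoinsIn arcs P {t}) {v v' : V} (hv : v ∈ P) (hv' : v' ∈ P) {c₁ c₂ c₃ : E}
    (hne : c₁ ≠ c₂) (hc₁ : c₁ ∈ tailCoins arcs P) (hc₂ : c₂ ∈ tailCoins arcs P)
    (hc₃ : c₃ ∈ tailCoins arcs P)
    (hleaf : bwdEvent arcs v {t} = openEdge c₁ ∩ openEdge c₂)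
    (hleaf' : bwdEvent arcs v' {t} = openEdge c₃) (s : V) {g₁ g₂ : Set V → R}
    (h₁ : Monotone g₁) (h₂ : Monotone g₂) (h₁0 : ∀ S, 0 ≤ g₁ S) (h₂0 : ∀ S, 0 ≤ g₂ S) :
    (∑ Z ∈ P.powerset.filter (fun Z => v ∈ Z ∧ v' ∈ Z),
        g₁ ↑Z * (prob p (traceLevel arcs {t} P Z) *
          prob p (avoidEvent (arcsOff arcs (P ∪ {t})) s (Z ∪ {t}))))
      * (∑ Z ∈ P.powerset.filter (fun Z => v ∈ Z ∧ v' ∈ Z),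
        g₂ ↑Z * (prob p (traceLevel arcs {t} P Z) *
          prob p (avoidEvent (arcsOff arcs (P ∪ {t})) s (Z ∪ {t})))) ≤
    (∑ Z ∈ P.powerset.filter (fun Z => v ∈ Z ∧ v' ∈ Z),
        g₁ ↑Z * g₂ ↑Z * (prob p (traceLevel arcs {t} P Z) *
          prob p (avoidEvent (arcsOff arcs (P ∪ {t})) s (Z ∪ {t}))))
      * (∑ Z ∈ P.powerset.filter (fun Z => v ∈ Z ∧ v' ∈ Z),
        prob p (traceLevel arcs {t} P Z) *
          prob p (avoidEvent (arcsOff arcs (P ∪ {t})) s (Z ∪ {t}))) :=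
  trace_pin_transfer p hp hT hv' hc₃ hleaf' s (fun Z => v ∈ Z) g₁ g₂ fun q hq =>
    trace_cu_pa₂ q hq hS hclosed hT hv hne hc₁ hc₂ hleaf s h₁ h₂ h₁0 h₂0

end PinTransfer

end Summit.Ventures.PercRepro2.Coin
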